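import Summits.QuantumFields.GaugeBoot.DiagonalRPTorusGaugeInvariantTwo
import HarnessLib

/-!
# Diagonal RP on the two-dimensional torus off the back layer, I: the fibrewise gauge action on
the back zigzag (gauge-boot, task L3(η))

HONEST FRAMING (cell `pub-gaugeboot`, page 1 of every file): the venture produces certified bounds
on lattice expectations at stated coupling, gauge group, dimension and torus size; NOT a mass gap,
NOT a continuum limit, NOT a string tension; NOT Yang–Mills-summit-bearing (barriers
`FixedCouplingUltralocality`, `PerturbativeInvisibility`). This module is part of a small POSITIVE
structural result about which positivity constraints a two-dimensional TORUS certificate may use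
(no two-dimensional certificate with a diagonal block exists or is planned); it discharges nothing
else.

Setting of `DiagonalRPTorusTwoGeometry.lean` / `DiagonalRPTorusTwoTwist.lean` /
`DiagonalRPTorusTwoZigzag.lean`: the square torus `(ℤ/L)²`, `k = y_i - y_j`, back layer `k = c`,
`c = L/2`, the swap `Θ` (`configDiagSwap`), the relabelling `T̂` (`configTau`) of the links
touching the back layer by the half-period translation `τ`, and the back zigzag of the closed
half — the `2L` links `(A_t, i)`, `(B_t, j)` between the layers `c - 1` and `c`.

* `ZL i j e` — `e` is a link of that zigzag (touches the back layer AND lies in the closed half);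
  `zig i j h U` — the FIBREWISE vertex action of a site function `h`: gauge-transform the zigzag
  links only (`U(e) ↦ h(x) U(e) h(x')⁻¹` for a zigzag link `e : x → x'`, all other links fixed).
  It is NOT a gauge transformation of the torus (the other links at the same vertices stay put);
  it is multiplicative in `h` (`zig_mul`) and splits into the commuting actions at the
  layer-`(c-1)` vertices (`onA`) and at the back-layer vertices (`onB`) (`zig_eq_zig_onA_onB`,
  `zig_onA_onB_comm`).
* **The half-turn is a fibrewise vertex action**: on the closed half, `T̂ U = zig (h(U)) U` with
  the rotation gauge `h(U) = hfun U` of `DiagonalRPTorusTwoZigzag.lean` (`configTau_apply_eq_zig`;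
  this is `gauge_zA` / `gauge_zB` read WITHOUT the untwisting map `Ψ₁`, which is why `4 ≤ L`
  suffices below); and `T̂ ∘ zig_h = zig_{h ∘ τ} ∘ T̂` (`configTau_zig`).
* Invariances: the crossing weight `E` (`crossE`) and every function of the reflected half are
  invariant under the layer-`(c-1)` action (`crossE_zig_onA`, `comp_configDiagSwap_zig`); the
  positive-side observable `g = F e^{β S_int}` (`gObs`) is invariant under the back-layer action
  as soon as `F` is invariant under the gauge transformations supported on the back layer
  (`gObs_zig_onB`).

Continued in `DiagonalRPTorusTwoZigzagAverage.lean` (measure preservation, the average) and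
`DiagonalRPTorusInnerHalf.lean` (the theorems). All statements are elementary and proved
(standard change of variables of lattice gauge theory, E. Seiler, LNP 159 (1982) Ch. 2; gauge
orbits on a cycle graph).
-/

open MeasureTheory Complex Finset Function
open scoped ComplexOrder ENNReal

namespace Summit.QuantumFields.GaugeBoot

open Literature.MathematicalPhysics.QuantumFieldTheory

noncomputable section

namespace DiagRPTwo

/-! ## The back zigzag and the fibrewise vertex action -/

section Zig

variable {L : ℕ} {i j : Fin 2} {G : Type*} [Group G]

/-- `e` is a link of the back zigzag of the closed half: it touches the back layer `k = c` and lies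
in the closed half `0 ≤ k ≤ c`. [shape] A parametric definition of a proposition — NOT a fact.
[folklore] -/
def ZL (i j : Fin 2) (e : Edge 2 L) : Prop := TW i j e ∧ InHalf i j e

/-- `ZL` is decidable. -/
instance decZL (i j : Fin 2) : DecidablePred (ZL (L := L) i j) := fun e => by
  unfold ZL InHalf; infer_instance

variable (i j) in
/-- The fibrewise vertex action of a site function `h` on the back zigzag: gauge-transform the
zigzag links, leave every other link fixed. -/
def zig (h : Site 2 L → G) (U : GaugeConfig 2 L G) : GaugeConfig 2 L G :=
  fun e => if ZL i j e then gaugeTransform h U e else U e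

/-- The action on a zigzag link. -/
theorem zig_apply_of_zl (h : Site 2 L → G) (U : GaugeConfig 2 L G) {e : Edge 2 L} (he : ZL i j e) :
    zig i j h U e = h e.1 * U e * (h (e.1.shift e.2))⁻¹ := by
  simp only [zig, if_pos he, gaugeTransform]

/-- The action does not touch the other links. -/
theorem zig_apply_of_not_zl (h : Site 2 L → G) (U : GaugeConfig 2 L G) {e : Edge 2 L}
    (he : ¬ZL i j e) : zig i j h U e = U e := by
  simp only [zig, if_neg he]

/-- The action is multiplicative in the site function. -/
theorem zig_mul (k h : Site 2 L → G) (U : GaugeConfig 2 L G) :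
    zig i j (k * h) U = zig i j k (zig i j h U) := by
  funext e
  by_cases he : ZL i j e
  · simp only [zig_apply_of_zl _ _ he, Pi.mul_apply, mul_inv_rev, mul_assoc]
  · simp only [zig_apply_of_not_zl _ _ he]

/-- Configurations agreeing on the closed half have images agreeing on the closed half. -/
theorem zig_apply_congr (h : Site 2 L → G) {U V : GaugeConfig 2 L G} {e : Edge 2 L}
    (hUV : U e = V e) : zig i j h U e = zig i j h V e := by
  by_cases he : ZL i j e
  · rw [zig_apply_of_zl _ _ he, zig_apply_of_zl _ _ he, hUV]
  · rw [zig_apply_of_not_zl _ _ he, zig_apply_of_not_zl _ _ he, hUV]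

variable [NeZero L]

/-- A function of the closed half, composed with the action, is a function of the closed half. -/
theorem dependsOn_comp_zig {α : Type*} {g : GaugeConfig 2 L G → α}
    (hg : DependsOn g (halfLinks (L := L) i j : Set (Edge 2 L))) (h : Site 2 L → G) :
    DependsOn (fun U => g (zig i j h U)) (halfLinks (L := L) i j : Set (Edge 2 L)) :=
  fun _ _ hUV => hg fun e he => zig_apply_congr h (hUV e he)

/-- A zigzag link runs from the layer `c - 1` to the back layer `c` or back (`L ≥ 4`). -/
theorem zl_layers (h4 : 4 ≤ L) (hij : i ≠ j) {e : Edge 2 L} (he : ZL i j e) :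
    (kd i j e.1 = cc L - 1 ∧ kd i j (e.1.shift e.2) = cc L) ∨
      (kd i j e.1 = cc L ∧ kd i j (e.1.shift e.2) = cc L - 1) := by
  rcases exists_eq_of_inHalf_of_tw h4 hij he.2 he.1 with h | h <;> rw [h]
  · exact Or.inl ⟨kd_zA hij _, kd_zA_shift hij _⟩
  · exact Or.inr ⟨kd_zA_shift hij _, by rw [zA_shift_shift hij, kd_zA hij]⟩

/-- **The half-turn of the back zigzag is a fibrewise vertex action**: on every link of the
closed half, `T̂ U = zig (h(U)) U` with the rotation gauge `h(U)` of
`DiagonalRPTorusTwoZigzag.lean` (`L ≥ 4`). -/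
theorem configTau_apply_eq_zig (h4 : 4 ≤ L) (hij : i ≠ j) (U : GaugeConfig 2 L G) {e : Edge 2 L}
    (he : InHalf i j e) : configTau i j U e = zig i j (hfun i j U) U e := by
  by_cases ht : TW i j e
  · rw [zig_apply_of_zl _ _ ⟨ht, he⟩, ← gaugeTransform_untwist_of_inHalf h4 hij U he, gaugeTransform,
      untwist_apply_of_tw U ht]
  · rw [configTau_apply_of_not_tw U ht, zig_apply_of_not_zl _ _ fun h => ht h.1]

omit [NeZero L] in
/-- `T̂ ∘ zig_h = zig_{h ∘ τ} ∘ T̂`. -/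
theorem configTau_zig (h : Site 2 L → G) (U : GaugeConfig 2 L G) :
    configTau i j (zig i j h U) = zig i j (h ∘ tauSite) (configTau i j U) := by
  funext e
  by_cases ht : TW i j e
  · have ht' : TW i j (tauEdge e) := (tw_tauEdge_iff e).2 ht
    rw [configTau_apply_of_tw _ ht]
    by_cases hh : InHalf i j e
    · have hh' : InHalf i j (tauEdge e) := (inHalf_tauEdge_iff e).2 hh
      rw [zig_apply_of_zl _ _ ⟨ht', hh'⟩, zig_apply_of_zl _ _ ⟨ht, hh⟩, configTau_apply_of_tw _ ht]
      simp only [tauEdge, Function.comp_apply, tauSite_shift]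
    · rw [zig_apply_of_not_zl _ _ fun h => hh ((inHalf_tauEdge_iff e).1 h.2),
        zig_apply_of_not_zl _ _ fun h => hh h.2, configTau_apply_of_tw _ ht]
  · rw [configTau_apply_of_not_tw _ ht, zig_apply_of_not_zl _ _ fun h => ht h.1,
      zig_apply_of_not_zl _ _ fun h => ht h.1, configTau_apply_of_not_tw _ ht]

/-- The action does not touch the swapped links of the closed half (`L ≥ 4` even). -/
theorem zig_apply_edgeDiagSwap (hL : Even L) (h4 : 4 ≤ L) (hij : i ≠ j) (h : Site 2 L → G)
    (U : GaugeConfig 2 L G) {e : Edge 2 L} (he : InHalf i j e) :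
    zig i j h U (edgeDiagSwap i j e) = U (edgeDiagSwap i j e) :=
  zig_apply_of_not_zl _ _ fun hz => not_inHalf_edgeDiagSwap hL h4 hij he hz.2

/-- A function of the closed half, evaluated on the swapped configuration, does not see the
action (`L ≥ 4` even). -/
theorem comp_configDiagSwap_zig {α : Type*} (hL : Even L) (h4 : 4 ≤ L) (hij : i ≠ j)
    {g : GaugeConfig 2 L G → α} (hg : DependsOn g (halfLinks (L := L) i j : Set (Edge 2 L)))
    (h : Site 2 L → G) (U : GaugeConfig 2 L G) :
    g (configDiagSwap i j (zig i j h U)) = g (configDiagSwap i j U) :=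
  hg fun _ he => zig_apply_edgeDiagSwap hL h4 hij h U (mem_halfLinks.1 (Finset.mem_coe.1 he))

end Zig

/-! ## The actions at the two layers -/

section Layers

variable {L : ℕ} {i j : Fin 2} {G : Type*} [Group G]

variable (i j) in
/-- Restriction of a site function to the layer `c - 1` (value `1` elsewhere). -/
def onA (k : Site 2 L → G) : Site 2 L → G := fun y => if kd i j y = cc L - 1 then k y else 1

variable (i j) in
/-- Restriction of a site function to the back layer `c` (value `1` elsewhere). -/
def onB (k : Site 2 L → G) : Site 2 L → G := fun y => if kd i j y = cc L then k y else 1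

/-- `onA` on the layer `c - 1`. -/
theorem onA_of_eq (k : Site 2 L → G) {y : Site 2 L} (hy : kd i j y = cc L - 1) : onA i j k y = k y :=
  if_pos hy

/-- `onA` off the layer `c - 1`. -/
theorem onA_of_ne (k : Site 2 L → G) {y : Site 2 L} (hy : kd i j y ≠ cc L - 1) : onA i j k y = 1 :=
  if_neg hy

/-- `onB` on the back layer. -/
theorem onB_of_eq (k : Site 2 L → G) {y : Site 2 L} (hy : kd i j y = cc L) : onB i j k y = k y :=
  if_pos hy

/-- `onB` off the back layer. -/
theorem onB_of_ne (k : Site 2 L → G) {y : Site 2 L} (hy : kd i j y ≠ cc L) : onB i j k y = 1 :=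
  if_neg hy

/-- `onA` is multiplicative. -/
theorem onA_mul (k h : Site 2 L → G) : onA i j (k * h) = onA i j k * onA i j h := by
  funext y
  by_cases hy : kd i j y = cc L - 1
  · simp only [Pi.mul_apply, onA_of_eq _ hy]
  · simp only [Pi.mul_apply, onA_of_ne _ hy, mul_one]

/-- `onA` commutes with the translation `τ` (which preserves `k`). -/
theorem onA_comp_tauSite (k : Site 2 L → G) : onA i j (k ∘ tauSite) = onA i j k ∘ tauSite := by
  funext y
  by_cases hy : kd i j y = cc L - 1
  · rw [Function.comp_apply, onA_of_eq _ hy, onA_of_eq _ (by rwa [kd_tauSite]), Function.comp_apply]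
  · rw [Function.comp_apply, onA_of_ne _ hy, onA_of_ne _ (by rwa [kd_tauSite])]

/-- The two restrictions commute pointwise (`L ≥ 4`). -/
theorem onA_mul_onB_comm (h4 : 4 ≤ L) (k k' : Site 2 L → G) :
    onA i j k * onB i j k' = onB i j k' * onA i j k := by
  funext y
  by_cases hA : kd i j y = cc L - 1
  · have hB : kd i j y ≠ cc L := fun h => cc_sub_one_ne_cc h4 (hA.symm.trans h)
    simp only [Pi.mul_apply, onA_of_eq _ hA, onB_of_ne _ hB, mul_one, one_mul]
  · simp only [Pi.mul_apply, onA_of_ne _ hA, mul_one, one_mul]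

/-- The two actions commute (`L ≥ 4`). -/
theorem zig_onA_onB_comm (h4 : 4 ≤ L) (k k' : Site 2 L → G) (U : GaugeConfig 2 L G) :
    zig i j (onA i j k) (zig i j (onB i j k') U) = zig i j (onB i j k') (zig i j (onA i j k) U) := by
  rw [← zig_mul, ← zig_mul, onA_mul_onB_comm h4]

variable [NeZero L]

/-- The action of a site function is the composite of its actions at the two layers (`L ≥ 4`). -/
theorem zig_eq_zig_onA_onB (h4 : 4 ≤ L) (hij : i ≠ j) (h : Site 2 L → G) (U : GaugeConfig 2 L G) :
    zig i j h U = zig i j (onA i j h) (zig i j (onB i j h) U) := by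
  rw [← zig_mul]
  funext e
  by_cases he : ZL i j e
  · have hcc : cc L ≠ cc L - 1 := fun h => cc_sub_one_ne_cc h4 h.symm
    rw [zig_apply_of_zl _ _ he, zig_apply_of_zl _ _ he]
    rcases zl_layers h4 hij he with ⟨h1, h2⟩ | ⟨h1, h2⟩
    · have h2' : kd i j (e.1.shift e.2) ≠ cc L - 1 := by rw [h2]; exact hcc
      simp only [Pi.mul_apply, onA_of_eq _ h1, onB_of_ne _ (by rw [h1]; exact cc_sub_one_ne_cc h4),
        onA_of_ne _ h2', onB_of_eq _ h2, mul_one, one_mul]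
    · have h1' : kd i j e.1 ≠ cc L - 1 := by rw [h1]; exact hcc
      simp only [Pi.mul_apply, onA_of_ne _ h1', onB_of_eq _ h1, onA_of_eq _ h2,
        onB_of_ne _ (by rw [h2]; exact cc_sub_one_ne_cc h4), mul_one, one_mul]
  · rw [zig_apply_of_not_zl _ _ he, zig_apply_of_not_zl _ _ he]

omit [NeZero L] in
/-- On the closed half, the back-layer action agrees with the gauge transformation by `onB k`
(a gauge transformation supported on the back layer). -/
theorem zig_onB_apply_eq_gaugeTransform (k : Site 2 L → G) (U : GaugeConfig 2 L G) {e : Edge 2 L}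
    (he : InHalf i j e) : zig i j (onB i j k) U e = gaugeTransform (onB i j k) U e := by
  by_cases ht : TW i j e
  · rw [zig_apply_of_zl _ _ ⟨ht, he⟩, gaugeTransform]
  · have h1 : kd i j e.1 ≠ cc L := fun h => ht (Or.inl h)
    have h2 : kd i j (e.1.shift e.2) ≠ cc L := fun h => ht (Or.inr h)
    rw [zig_apply_of_not_zl _ _ fun h => ht h.1, gaugeTransform, onB_of_ne _ h1, onB_of_ne _ h2,
      one_mul, inv_one, mul_one]

end Layers

/-! ## Invariance of the crossing weight and of the positive-side observable -/

section Invariance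

variable {L N : ℕ} [NeZero L] {i j : Fin 2} {G : Type*} [Group G] [TopologicalSpace G]
  [IsTopologicalGroup G] [CompactSpace G] (ρ : G →* Matrix (Fin N) (Fin N) ℂ)

omit [TopologicalSpace G] [IsTopologicalGroup G] [CompactSpace G] in
/-- The links of a mirror plaquette do not touch the back layer (`L ≥ 4`). -/
theorem not_tw_of_mem_blk_of_kd_eq_zero (h4 : 4 ≤ L) (hij : i ≠ j) {y : Site 2 L}
    (hy : kd i j y = 0) {e : Edge 2 L} (he : e ∈ blk i j y) : ¬TW i j e := by
  have hi : kd i j (y.shift i) = 1 := by rw [kd_shift_left hij, hy, zero_add]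
  have hj : kd i j (y.shift j) = -1 := by rw [kd_shift_right hij, hy, zero_sub]
  have hij' : kd i j ((y.shift i).shift j) = 0 := by rw [kd_shift_right hij, hi, sub_self]
  have hji' : kd i j ((y.shift j).shift i) = 0 := by rw [kd_shift_left hij, hj, neg_add_cancel]
  have h0 : (0 : ZMod L) ≠ cc L := fun h => cc_ne_zero h4 h.symm
  have h1 : (1 : ZMod L) ≠ cc L := fun h => cc_ne_one h4 h.symm
  have hm1 : (-1 : ZMod L) ≠ cc L := fun h => cc_ne_neg_one h4 h.symm
  rw [mem_blk] at he
  rcases he with rfl | rfl | rfl | rfl <;> rintro (h | h) <;> simp only [hy, hi, hj, hij', hji'] at h <;>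
    first | exact h0 h | exact h1 h | exact hm1 h

omit [TopologicalSpace G] [IsTopologicalGroup G] [CompactSpace G] in
/-- A mirror plaquette term does not see the action (`L ≥ 4`). -/
theorem rr_zig_of_kd_eq_zero (h4 : 4 ≤ L) (hij : i ≠ j) (h : Site 2 L → G) (U : GaugeConfig 2 L G)
    {y : Site 2 L} (hy : kd i j y = 0) : rr ρ i j (zig i j h U) y = rr ρ i j U y :=
  dependsOn_blk i j y (fun c d => ((ρ (c * d⁻¹)).trace).re) fun _ he =>
    zig_apply_of_not_zl _ _ fun hz => not_tw_of_mem_blk_of_kd_eq_zero h4 hij hy he hz.1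

omit [NeZero L] [TopologicalSpace G] [IsTopologicalGroup G] [CompactSpace G] in
/-- The transport `C_y` at a back-layer site does not see the action (its links leave the closed
half; `L ≥ 4`). -/
theorem cT_zig_of_kd_eq_cc (h4 : 4 ≤ L) (hij : i ≠ j) (h : Site 2 L → G) (U : GaugeConfig 2 L G)
    {y : Site 2 L} (hy : kd i j y = cc L) : cT i j (zig i j h U) y = cT i j U y := by
  have hv : (kd i j (y.shift i)).val = L / 2 + 1 := by
    rw [kd_shift_left hij, hy]; exact val_cc_add_one h4
  have h1 : ¬InHalf i j (y, i) := fun h => by have := h.2; simp only [hv] at this; omega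
  have h2 : ¬InHalf i j (y.shift i, j) := fun h => by have := h.1; simp only [hv] at this; omega
  rw [cT, cT, zig_apply_of_not_zl _ _ fun hz => h1 hz.2, zig_apply_of_not_zl _ _ fun hz => h2 hz.2]

omit [TopologicalSpace G] [IsTopologicalGroup G] [CompactSpace G] in
/-- The transport `D_y` at a back-layer site is invariant under the layer-`(c-1)` action: its two
links share the layer-`(c-1)` vertex `y + e_j` (`L ≥ 4`). -/
theorem dT_zig_onA_of_kd_eq_cc (h4 : 4 ≤ L) (hij : i ≠ j) (k : Site 2 L → G) (U : GaugeConfig 2 L G)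
    {y : Site 2 L} (hy : kd i j y = cc L) : dT i j (zig i j (onA i j k) U) y = dT i j U y := by
  obtain ⟨hin1, hin2⟩ := inHalf_dT_links h4 hij hy
  have hm : kd i j (y.shift j) = cc L - 1 := by rw [kd_shift_right hij, hy]
  have hb : kd i j ((y.shift j).shift i) = cc L := by rw [kd_shift_left hij, hm, sub_add_cancel]
  have ht1 : TW i j (y, j) := Or.inl hy
  have ht2 : TW i j (y.shift j, i) := Or.inr hb
  have hne : cc L ≠ cc L - 1 := fun h => cc_sub_one_ne_cc h4 h.symm
  rw [dT, dT, zig_apply_of_zl _ _ ⟨ht1, hin1⟩, zig_apply_of_zl _ _ ⟨ht2, hin2⟩]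
  simp only [onA_of_ne k (show kd i j y ≠ cc L - 1 by rw [hy]; exact hne), onA_of_eq k hm,
    onA_of_ne k (show kd i j ((y.shift j).shift i) ≠ cc L - 1 by rw [hb]; exact hne), one_mul,
    inv_one, mul_one, mul_assoc, inv_mul_cancel_left]

omit [TopologicalSpace G] [IsTopologicalGroup G] [CompactSpace G] in
/-- A back-layer plaquette term is invariant under the layer-`(c-1)` action (`L ≥ 4`). -/
theorem rr_zig_onA_of_kd_eq_cc (h4 : 4 ≤ L) (hij : i ≠ j) (k : Site 2 L → G) (U : GaugeConfig 2 L G)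
    {y : Site 2 L} (hy : kd i j y = cc L) : rr ρ i j (zig i j (onA i j k) U) y = rr ρ i j U y := by
  rw [rr, rr, cT_zig_of_kd_eq_cc h4 hij _ U hy, dT_zig_onA_of_kd_eq_cc h4 hij k U hy]

omit [TopologicalSpace G] [IsTopologicalGroup G] [CompactSpace G] in
/-- **The crossing weight is invariant under the layer-`(c-1)` action** (`L ≥ 4`). -/
theorem crossE_zig_onA (h4 : 4 ≤ L) (hij : i ≠ j) (β : ℝ) (k : Site 2 L → G)
    (U : GaugeConfig 2 L G) : crossE ρ i j β (zig i j (onA i j k) U) = crossE ρ i j β U := by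
  have h0 : ∑ y ∈ S0 i j, rr ρ i j (zig i j (onA i j k) U) y = ∑ y ∈ S0 i j, rr ρ i j U y :=
    Finset.sum_congr rfl fun y hy =>
      rr_zig_of_kd_eq_zero ρ h4 hij _ U ((kd_eq_zero_iff y).2 (mem_S0.1 hy))
  have hc : ∑ y ∈ Sc i j, rr ρ i j (zig i j (onA i j k) U) y = ∑ y ∈ Sc i j, rr ρ i j U y :=
    Finset.sum_congr rfl fun y hy =>
      rr_zig_onA_of_kd_eq_cc ρ h4 hij k U ((kd_eq_cc_iff h4 y).2 (mem_Sc.1 hy))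
  rw [crossE, crossE, h0, hc]

omit [TopologicalSpace G] [IsTopologicalGroup G] [CompactSpace G] in
/-- The links of the interior plaquettes of the closed half are links of the closed half. -/
theorem biUnion_Sp_blk_subset_halfLinks (h4 : 4 ≤ L) (hij : i ≠ j) :
    (((Sp (L := L) i j).biUnion (blk i j) : Finset (Edge 2 L)) : Set (Edge 2 L)) ⊆
      (halfLinks (L := L) i j : Set (Edge 2 L)) := by
  intro e he
  obtain ⟨y, hy, hey⟩ := Finset.mem_biUnion.1 (Finset.mem_coe.1 he)
  exact Finset.mem_coe.2 (mem_halfLinks.2 (inHalf_blk h4 hij hy hey))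

omit [TopologicalSpace G] [IsTopologicalGroup G] [CompactSpace G] in
/-- **The positive-side observable is invariant under the back-layer action** when `F` is an
observable of the closed half invariant under the gauge transformations supported on the back
layer (`L ≥ 4`). -/
theorem gObs_zig_onB (h4 : 4 ≤ L) (hij : i ≠ j) (β : ℝ) {F : GaugeConfig 2 L G → ℂ}
    (hFH : IsDiagonalHalfObservable i j F)
    (hFB : ∀ γ : Site 2 L → G, (∀ y, kd i j y ≠ cc L → γ y = 1) →
      ∀ U, F (gaugeTransform γ U) = F U)
    (k : Site 2 L → G) (U : GaugeConfig 2 L G) :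
    gObs ρ i j β F (zig i j (onB i j k) U) = gObs ρ i j β F U := by
  have hag : ∀ e ∈ (halfLinks (L := L) i j : Set (Edge 2 L)),
      zig i j (onB i j k) U e = gaugeTransform (onB i j k) U e := fun e he =>
    zig_onB_apply_eq_gaugeTransform k U (mem_halfLinks.1 (Finset.mem_coe.1 he))
  have hF : F (zig i j (onB i j k) U) = F U := by
    rw [dependsOn_halfLinks hFH hag]
    exact hFB _ (fun y hy => onB_of_ne k hy) U
  have hS : ∑ y ∈ Sp i j, rr ρ i j (zig i j (onB i j k) U) y = ∑ y ∈ Sp i j, rr ρ i j U y := by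
    have h1 : ∑ y ∈ Sp i j, rr ρ i j (zig i j (onB i j k) U) y =
        ∑ y ∈ Sp i j, rr ρ i j (gaugeTransform (onB i j k) U) y :=
      dependsOn_sum_rr ρ i j (Sp i j) fun e he => hag e (biUnion_Sp_blk_subset_halfLinks h4 hij he)
    rw [h1]
    exact Finset.sum_congr rfl fun y _ => rr_gaugeTransform ρ i j _ U y
  simp only [gObs, hF, hS]

end Invariance

end DiagRPTwo

end

end Summit.QuantumFields.GaugeBoot
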